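import Summits.FinalStateConjecture.FinalStateConjecture.Theses.StarvedNecks

/-!
# `NecksCertify` (crux stmt-FinalStateConjecture-13549, route StarvedNecks) — negative side:
# the SEAMED tube clauses exclude comoving holes; `¬ NecksCertify` modulo an equal-velocity binary

Refuter seat `refuter-cdisprove-stmt-FinalStateConjecture-13549-0` (cdisprove), 2026-08-16;
workfile `Cruxes/NecksCertify/Disproof.lean`.  Sorry-free, axioms `propext`, `Classical.choice`,
`Quot.sound`.  Contents:

* `false_of_parallel_boosts` — the kernel-checked heart of the paper finding of
  `refuter-rattack-stmt-FinalStateConjecture-13549-0` (item evidence EVIDENCE.md §3, 2026-08-15):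
  clauses S8 (the flat tube of hole `j'` sits with margin `2` inside its certified tube) and S12
  (certified tubes `+1` of different holes are COORDINATE-disjoint at every flat-late point) of the
  crux's `Sm`, with `R ≥ −1`, contradict two distinct holes `j ≠ j'` with equal asymptotic
  four-velocity `Λⱼ∂₀ = Λⱼ'∂₀` once the flat tube of `j'` at some flat-late time `T` is as wide as
  the `j'`-radius of the axis of `j` (a time-independent number, because `Λⱼ'⁻¹Λⱼ∂₀ = ∂₀` and the
  Kerr–Schild radius ignores the time coordinate).  Witness point: the axis of hole `j` at flat time
  `T` — its `j`-radius is `0 ≤ Rⱼ + 1`, so S12 puts it OUTSIDE the certified tube of `j'`, while S8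
  puts it INSIDE with margin `2`.  `false_of_parallel_boosts_of_tendsto`: the same with
  `Tendsto (d.excision j') atTop atTop`.
* `EqualVelocityBinaryWitness` — hypothesis `H` (physics-level, NOT constructible in the tree):
  some admissible datum has an MGHD whose exterior carries an honest `C⁴` decomposition (the
  crux's antecedent, VERBATIM the crux's `let`-bound `Hc`, `Hf`) while every honest-core (`Hc`),
  seamed (`Sm`, verbatim) `C²` decomposition of that exterior has two distinct holes with the same
  `Λᵢ∂₀` and unbounded excision radii.  Intended inhabitant: threshold ("parabolic", head-on)
  two-black-hole recessions, both holes asymptotically at the centre-of-mass velocity, separation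
  `∼ t^{2/3}` (sublinear drifts are explicitly admitted by
  `FinalStateDecomposition.tendsto_excision_div`).
* `NecksCertify_false_of_EqualVelocityBinaryWitness : H → ¬ NecksCertify` — NEGATIVE LEMMA MODULO
  `H` (the item stays open; `H` is the construction it waits for).  Repair already recorded on the
  item (rattack, PICKED.md): add pairwise distinct asymptotic 3-velocities to `Hc` (C′); the
  witness misses C′, and this file says nothing against C′.
-/

noncomputable section

open scoped Manifold ContDiff Topology ENNReal
open Filter Set Literature.Geometry.Lorentzian

namespace Summit.FinalStateConjecture.FinalStateConjecture.Theorems.NecksCertify.Negative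


/-! ## §1 Coordinate geometry: S8 + S12 exclude comoving holes -/

/-- The Kerr–Schild radius is invariant under translations along the time axis `∂₀`
(it depends on the spatial coordinates only). -/
theorem kerr_radius_add_smul_basisVector_zero (a s : ℝ) (w : E4) :
    Kerr.radius a (s • E4.basisVector 0 + w) = Kerr.radius a w := by
  have h1 : E4.spatialNorm (s • E4.basisVector 0 + w) = E4.spatialNorm w := by
    unfold E4.spatialNorm
    congr 1
    ext i
    simp [E4.spatial_apply, Fin.succ_ne_zero]
  have h2 : (s • E4.basisVector 0 + w) 3 = w 3 := by simp
  unfold Kerr.radius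
  rw [h1, h2]

/-- The Kerr–Schild radius vanishes on the time axis. -/
theorem kerr_radius_smul_basisVector_zero (a s : ℝ) :
    Kerr.radius a (s • E4.basisVector 0) = 0 := by
  have h1 : E4.spatialNorm (s • E4.basisVector 0 : E4) = 0 := by
    unfold E4.spatialNorm
    rw [norm_eq_zero]
    ext i
    simp [E4.spatial_apply, Fin.succ_ne_zero]
  have h2 : (s • E4.basisVector 0 : E4) 3 = 0 := by simp
  unfold Kerr.radius
  rw [h1, h2]
  have h3 : ((0 : ℝ) ^ 2 - a ^ 2) ^ 2 + 4 * a ^ 2 * (0 : ℝ) ^ 2 = (a ^ 2) ^ 2 := by ring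
  rw [h3, Real.sqrt_sq (sq_nonneg a)]
  have h4 : ((0 : ℝ) ^ 2 - a ^ 2 + a ^ 2) / 2 = 0 := by ring
  rw [h4, Real.sqrt_zero]

/-- The time component of `Λ ∂₀` does not vanish for a Lorentz transformation `Λ`
(`η(Λ∂₀, Λ∂₀) = −1`). -/
theorem lorentz_basisVector_zero_apply_zero_ne_zero (Λ : lorentzGroup) :
    ((Λ : E4 ≃L[ℝ] E4) (E4.basisVector 0)) 0 ≠ 0 := by
  intro h0
  have h := Λ.2 (E4.basisVector 0) (E4.basisVector 0)
  rw [Minkowski.bilin_basisVector_zero, Minkowski.bilin_apply, h0] at h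
  have hnn : (0 : ℝ) ≤ ∑ i : Fin 3, ((Λ : E4 ≃L[ℝ] E4) (E4.basisVector 0)) i.succ *
      ((Λ : E4 ≃L[ℝ] E4) (E4.basisVector 0)) i.succ :=
    Finset.sum_nonneg fun i _ ↦ mul_self_nonneg _
  linarith

/-- **Core negative lemma (coordinate geometry of the SEAMED tubes).** Clauses S8 (flat tubes
lie deep inside the certified tubes) and S12 (certified tubes of different holes are
coordinate-disjoint) of `Sm`, together with `R ≥ −1`, are incompatible with two distinct holes
`j ≠ j'` having the SAME asymptotic four-velocity `Λⱼ∂₀ = Λⱼ'∂₀` as soon as the flat tube of `j'`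
at some flat-late time `T` is at least as wide as the (time-independent) `j'`-radius of the axis of
`j`. Witness point: the point of the axis of hole `j` at flat time `T`. -/
theorem false_of_parallel_boosts {𝓢 : Spacetime.{0} 4} {O : Set 𝓢.carrier}
    (d : FinalStateDecomposition 𝓢 O 2) (R : Fin d.N → ℝ → ℝ)
    (hR : ∀ j s, -1 ≤ R j s)
    (S8 : ∀ j (y : E4), d.τ₀ ≤ y 0 → (d.background j).radius y ≤ d.excision j (y 0) →
      (d.background j).radius y + 2 ≤ R j ((d.background j).time y))
    (S12 : ∀ j j' (y : E4), j ≠ j' → (d.τ₀ ≤ y 0 ∨ d.τ₀ ≤ (d.background j).time y) →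
      (d.background j).radius y ≤ R j ((d.background j).time y) + 1 →
      R j' ((d.background j').time y) + 1 < (d.background j').radius y)
    {j j' : Fin d.N} (hne : j ≠ j')
    (hpar : ((d.motion j).1 : E4 ≃L[ℝ] E4) (E4.basisVector 0) =
      ((d.motion j').1 : E4 ≃L[ℝ] E4) (E4.basisVector 0))
    (hgrow : ∃ T, d.τ₀ ≤ T ∧ (d.background j').radius (d.motion j).2 ≤ d.excision j' T) :
    False := by
  obtain ⟨T, hT, hρ⟩ := hgrow
  set u : E4 := ((d.motion j).1 : E4 ≃L[ℝ] E4) (E4.basisVector 0) with hu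
  have hu0 : u 0 ≠ 0 := lorentz_basisVector_zero_apply_zero_ne_zero _
  set s : ℝ := (T - (d.motion j).2 0) / u 0 with hs
  set y : E4 := s • u + (d.motion j).2 with hy
  have hy0 : y 0 = T := by
    simp only [hy, hs, PiLp.add_apply, PiLp.smul_apply, smul_eq_mul]
    rw [div_mul_cancel₀ _ hu0]
    ring
  have hPj : poincareInv (d.motion j).1 (d.motion j).2 y = s • E4.basisVector 0 := by
    simp only [poincareInv, hy, add_sub_cancel_right, map_smul, hu,
      ContinuousLinearEquiv.symm_apply_apply]
  have hPj' : poincareInv (d.motion j').1 (d.motion j').2 y =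
      s • E4.basisVector 0 + ((d.motion j').1 : E4 ≃L[ℝ] E4).symm ((d.motion j).2 - (d.motion j').2) := by
    have h1 : y - (d.motion j').2 = s • u + ((d.motion j).2 - (d.motion j').2) := by
      rw [hy]; abel
    simp only [poincareInv, h1, map_add, map_smul]
    rw [hpar, ContinuousLinearEquiv.symm_apply_apply]
  have hrj : (d.background j).radius y = 0 := by
    show Kerr.radius (d.spin j) (poincareInv (d.motion j).1 (d.motion j).2 y) = 0
    rw [hPj]
    exact kerr_radius_smul_basisVector_zero _ _
  have hrj' : (d.background j').radius y = (d.background j').radius (d.motion j).2 := by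
    show Kerr.radius (d.spin j') (poincareInv (d.motion j').1 (d.motion j').2 y) =
      Kerr.radius (d.spin j') (poincareInv (d.motion j').1 (d.motion j').2 (d.motion j).2)
    rw [hPj', kerr_radius_add_smul_basisVector_zero]
    rfl
  have h8 := S8 j' y (by rw [hy0]; exact hT) (by rw [hrj', hy0]; exact hρ)
  have h12 := S12 j j' y hne (Or.inl (by rw [hy0]; exact hT))
    (by rw [hrj]; linarith [hR j ((d.background j).time y)])
  linarith

/-- The same, with the growth hypothesis in the form "the excision radius of `j'` tends to
infinity" (forced on every honest decomposition by flat convergence, since `Mⱼ' > 0`). -/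
theorem false_of_parallel_boosts_of_tendsto {𝓢 : Spacetime.{0} 4} {O : Set 𝓢.carrier}
    (d : FinalStateDecomposition 𝓢 O 2) (R : Fin d.N → ℝ → ℝ)
    (hR : ∀ j s, -1 ≤ R j s)
    (S8 : ∀ j (y : E4), d.τ₀ ≤ y 0 → (d.background j).radius y ≤ d.excision j (y 0) →
      (d.background j).radius y + 2 ≤ R j ((d.background j).time y))
    (S12 : ∀ j j' (y : E4), j ≠ j' → (d.τ₀ ≤ y 0 ∨ d.τ₀ ≤ (d.background j).time y) →
      (d.background j).radius y ≤ R j ((d.background j).time y) + 1 →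
      R j' ((d.background j').time y) + 1 < (d.background j').radius y)
    {j j' : Fin d.N} (hne : j ≠ j')
    (hpar : ((d.motion j).1 : E4 ≃L[ℝ] E4) (E4.basisVector 0) =
      ((d.motion j').1 : E4 ≃L[ℝ] E4) (E4.basisVector 0))
    (hgrow : Tendsto (d.excision j') atTop atTop) : False :=
  false_of_parallel_boosts d R hR S8 S12 hne hpar
    (((eventually_ge_atTop d.τ₀).and
      (hgrow.eventually_ge_atTop ((d.background j').radius (d.motion j).2))).exists)


/-! ## §2 `¬ NecksCertify` modulo an equal-velocity binary -/

/-- **Hypothesis `H` (physics-level; not constructible in the tree): an equal-velocity binary with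
honest charts exists.**  With `Hc`, `Hf`, `Sm` VERBATIM the three `let`-bound bundles of
`StarvedNecks.NecksCertify`: there are a connected `3`-manifold `X`, an admissible vacuum datum `D`
on it, a maximal vacuum Cauchy development `𝒟` of `D`, and a `C⁴` final-state decomposition `d` of
`O = J⁺(ιX) ∩ I⁻(d.charted)` with `Hc ∧ Hf` at some `R₀` (the antecedent of `NecksCertify`), such
that EVERY `C²` final-state decomposition `d₂` of the same exterior with `Hc` at some `R₀'` and `Sm`
for some radii `R` has two distinct holes with the same asymptotic four-velocity `Λᵢ∂₀ = Λⱼ∂₀` and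
all excision radii tending to infinity.  Intended inhabitant: a threshold ("parabolic") head-on
two-black-hole recession — both holes asymptotically at the centre-of-mass velocity, separation
`∼ t^{2/3}` (admitted by `FinalStateDecomposition.tendsto_excision_div`); there one atlas (S6) pins
`Λᵢ∂₀` to the physical asymptotic velocity up to `o(t)` shears of the near-isometric flat chart,
and `Mᵢ > 0` with flat `C²` convergence next to hole `i` forces `ρᵢ → ∞`.  Existence of such an
MGHD with honest charts is open (codimension `≥ 1` in the data, but `NecksCertify` is pointwise in
the datum).  Source of the witness: item evidence EVIDENCE.md of
`refuter-rattack-stmt-FinalStateConjecture-13549-0` (2026-08-15), §4; Dafermos–Luk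
arXiv:1710.01722, §1.2.1 ("finitely many Kerr black holes moving away from each other" — equal
velocities are not excluded by the conjecture's wording).
[topic: Summits/FinalStateConjecture/FinalStateConjecture — multi-black-hole kinematics] -/
def EqualVelocityBinaryWitness : Prop :=
  open Literature.Geometry.Lorentzian in open scoped ContDiff ENNReal in let Hc := ( fun (𝓢 : Spacetime.{0} 4) (O : Set 𝓢.carrier) (k : ℕ) (d : FinalStateDecomposition 𝓢 O k) (R₀ : ℝ) => let B := d.background; let t := fun i ↦ (B i).time; let r := fun i ↦ (B i).radius; let Ψ := d.chart; (∀ i, Kerr.IsSubextremal (d.mass i) (d.spin i) ∧ 100 * d.mass i ≤ R₀ ∧ 0 < ((d.motion i).1 : E4 ≃L[ℝ] E4) (E4.basisVector 0) 0) ∧ (∀ i (ϱ τ₂ : ℝ), R₀ ≤ ϱ → d.τ₀ < τ₂ → Ψ i '' {x | d.τ₀ < t i x.1 ∧ t i x.1 < τ₂ ∧ r i x.1 < ϱ} ⊆ 𝓢.metric.causalPast 𝓢.timeOrientation (Ψ i '' (B i).truncTimeSlab ϱ τ₂)) ∧ (∀ i (τ' : ℝ) (ϱ : ℝ → ℝ),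 Continuous ϱ → d.τ₀ < τ' → let A := Ψ i '' {x | τ' ≤ t i x.1 ∧ r i x.1 ≤ ϱ (t i x.1)}; closure A ∩ O ⊆ A) ∧ (∀ y : d.flatDomain, d.τ₀ < y.1 0 → 𝓢.timeOrientation.IsFutureDirected (mfderiv 𝓘(ℝ, E4) (𝓡 4) d.flatChart y (E4.basisVector 0))) ); let Hf := ( fun (𝓢 : Spacetime.{0} 4) (O : Set 𝓢.carrier) (k : ℕ) (d : FinalStateDecomposition 𝓢 O k) (R₀ : ℝ) => let B := d.background; let t := fun i ↦ (B i).time; let r := fun i ↦ (B i).radius; let Φ := d.flatChart; (∀ τ₂ : ℝ, d.τ₀ < τ₂ → Φ '' {y | d.τ₀ < y.1 0 ∧ y.1 0 < τ₂} ⊆ 𝓢.metric.causalPast 𝓢.timeOrientation (Φ '' (Minkowski.backgroundOn d.flatDomain).timeSlab τ₂)) ∧ (∀ τ' : ℝ, d.τ₀ < τ' → closure (Φ '' {y | τ' ≤ y.1 0 ∧ ∀ i, d.excision i (y.1 0) + 1 ≤ r i y.1}) ⊆ Φ '' {y | τ' ≤ y.1 0}) ∧ (∀ i, ∃ T : ℝ,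 supCkENorm (Subtype.val '' {x : (B i).domain | T ≤ t i x.1 ∧ R₀ ≤ r i x.1 ∧ ∀ j, j ≠ i → r i x.1 ≤ r j x.1}) 0 (𝓢.deviationExtend (B i) (d.chart i)) ≤ ENNReal.ofReal (1 / (10 * ‖(((d.motion i).1 : E4 ≃L[ℝ] E4) : E4 →L[ℝ] E4)‖ ^ 2))) ); let Sm := ( fun (𝓢 : Spacetime.{0} 4) (O : Set 𝓢.carrier) (d : FinalStateDecomposition 𝓢 O 2) (R : Fin d.N → ℝ → ℝ) (R₀ : ℝ) => let B := d.background; let t := fun i ↦ (B i).time; let r := fun i ↦ (B i).radius; let Λ := fun i ↦ ((d.motion i).1 : E4 ≃L[ℝ] E4); let Φ := d.flatChart; let Ψ := d.chart; let ρ := d.excision; (∀ i, Monotone (R i) ∧ Continuous (R i) ∧ ∀ s, R₀ + 4 ≤ R i s ∧ R₀ ≤ ρ i s) ∧ (∀ i, Tendsto (fun τ ↦ 𝓢.truncDeviationCk (B i) (Ψ i) 2 (R i τ) τ) atTop (𝓝 0)) ∧ supCkENorm (Subtype.val '' {y : d.flatDomain | d.τ₀ ≤ y.1 0}) 0 (𝓢.deviationExtend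 (Minkowski.backgroundOn d.flatDomain) Φ) ≤ 10⁻¹ ∧ (∀ i, supCkENorm (Subtype.val '' {x : (B i).domain | (d.τ₀ ≤ t i x.1 ∨ d.τ₀ ≤ x.1 0) ∧ R₀ ≤ r i x.1 ∧ r i x.1 ≤ R i (t i x.1)}) 0 (𝓢.deviationExtend (B i) (Ψ i)) ≤ ENNReal.ofReal (1 / (10 * ‖(Λ i : E4 →L[ℝ] E4)‖ ^ 2))) ∧ (∀ i (x : (B i).domain), (d.τ₀ ≤ t i x.1 ∨ d.τ₀ ≤ x.1 0) → R₀ ≤ r i x.1 → r i x.1 ≤ R i (t i x.1) → 𝓢.timeOrientation.IsFutureDirected (mfderiv 𝓘(ℝ, E4) (𝓡 4) (Ψ i) x ((Λ i) (E4.basisVector 0)))) ∧ (∀ i (y : E4) (hy : y ∈ (B i).domain), d.τ₀ ≤ y 0 → (∀ j, ρ j (y 0) < r j y) → r i y ≤ R i (t i y) + 1 → ∃ hy' : y ∈ d.flatDomain, Ψ i ⟨y, hy⟩ = Φ ⟨y, hy'⟩) ∧ (∀ y : d.flatDomain, d.τ₀ ≤ y.1 0 → ∀ j, ρ j (y.1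 0) < r j y.1) ∧ (∀ j (y : E4), d.τ₀ ≤ y 0 → r j y ≤ ρ j (y 0) → r j y + 2 ≤ R j (t j y)) ∧ (∀ j (y : E4), d.τ₀ ≤ t j y → r j y ≤ R j (t j y) + 2 → t j y ≤ y 0) ∧ (∀ j, Ψ j '' {x | d.τ₀ < t j x.1 ∧ R j (t j x.1) + 1 < r j x.1} ⊆ d.radiationZone) ∧ (∀ τ' : ℝ, d.τ₀ < τ' → closure (Φ '' {y | τ' ≤ y.1 0}) ⊆ Φ '' {y | τ' ≤ y.1 0} ∪ ⋃ j, Ψ j '' {x | τ' ≤ x.1 0 ∧ r j x.1 = ρ j (x.1 0)}) ∧ (∀ j j' (y : E4), j ≠ j' → (d.τ₀ ≤ y 0 ∨ d.τ₀ ≤ t j y) → r j y ≤ R j (t j y) + 1 → R j' (t j' y) + 1 < r j' y) ); ∃ (X : Type) (_ : TopologicalSpace X) (_ : ChartedSpace E3 X) (_ : IsManifold (𝓡 3) ∞ X) (_ : ConnectedSpace X) (D : InitialDataSet (𝓡 3) X) (_ : D ∈ admissibleVacuumData X) (𝒟 : VacuumCauchyDevelopment D) (_ : 𝒟.IsMaximal)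 (O : Set 𝒟.carrier) (d : FinalStateDecomposition 𝒟.toSpacetime O 4) (R₀ : ℝ), O = exteriorOf 𝒟.toCauchyDevelopment d.charted ∧ Hc 𝒟.toSpacetime O 4 d R₀ ∧ Hf 𝒟.toSpacetime O 4 d R₀ ∧ ∀ (d₂ : FinalStateDecomposition 𝒟.toSpacetime O 2) (R : Fin d₂.N → ℝ → ℝ) (R₀' : ℝ), O = exteriorOf 𝒟.toCauchyDevelopment d₂.charted → Hc 𝒟.toSpacetime O 2 d₂ R₀' → Sm 𝒟.toSpacetime O d₂ R R₀' → (∃ i j : Fin d₂.N, i ≠ j ∧ ((d₂.motion i).1 : E4 ≃L[ℝ] E4) (E4.basisVector 0) = ((d₂.motion j).1 : E4 ≃L[ℝ] E4) (E4.basisVector 0)) ∧ ∀ j, Tendsto (d₂.excision j) atTop atTop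

/-- **`¬ NecksCertify` modulo `H = EqualVelocityBinaryWitness`** (negative lemma modulo `H`; the
crux item stays open).  Proof: apply the crux to the honest `C⁴` input of `H`; the resulting
honest-core, seamed `C²` decomposition has `R ≥ R₀' + 4 ≥ 100·Mᵢ + 4 > −1` (S1, `Hc`), two
comoving holes and unbounded excision radii (by `H`), contradicting `false_of_parallel_boosts`
through S8 and S12. -/
theorem NecksCertify_false_of_EqualVelocityBinaryWitness (hH : EqualVelocityBinaryWitness) :
    ¬ Theses.StarvedNecks.NecksCertify := by
  intro hS
  obtain ⟨X, _, _, _, _, D, hD, 𝒟, h𝒟, O, d, R₀, hO, hc, hf, hW⟩ := hH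
  obtain ⟨d₂, R, R₀', hO₂, hc₂, hsm⟩ := hS X D hD 𝒟 h𝒟 O d R₀ hO hc hf
  obtain ⟨⟨i, j, hij, hpar⟩, hgrow⟩ := hW d₂ R R₀' hO₂ hc₂ hsm
  obtain ⟨h1, -, -, -, -, -, -, h8, -, -, -, h12⟩ := hsm
  have hR₀' : 0 ≤ R₀' := by
    have ha := (hc₂.1 i).2.1
    have hb := d₂.mass_pos i
    linarith
  exact false_of_parallel_boosts_of_tendsto d₂ R
    (fun j s ↦ by linarith [((h1 j).2.2 s).1]) h8 h12 hij hpar (hgrow j)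

end Summit.FinalStateConjecture.FinalStateConjecture.Theorems.NecksCertify.Negative

end
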